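import Summits.NavierStokesRegularity.NavierStokesRegularity.Theorems.ScenarioCensusRowF1RateTableRows
import HarnessLib

/-!
# LINE 26 «rate-table» port, part 5/5: §9 (cont.) corollaries in kernel (sign rows, eventual threshold rows), unification with LINE 22's `F1iq` (`rowF1iq_of_rowF1im`,
# `rowF1iq_holds'`); census KEYS `Row_F1im` / `Row_F1id` + `_excluded`, floors DM / DI, edge F1im ⇒ F1iq

Re-homed for the scenario census (typer seat ns-census-typer-1 g9; the cells F1im / F1id and the floors DM / DI are MEMBERS OF RECORD «DECIDED IN KERNEL IN FILES» of row F1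
since census v1.78 (critic idea-crit-3 PASS; ref ns-census-ref g10 PRE-CHECK ✓ §15.23 item 45; lead-presearch label); this port makes them TREE-decided): VERBATIM PORT
of the NEW declarations (§1 material / ideal read-outs, §7 maximum principles, §9 rows) of ns-idea-3 LINE 26 «rate-table»,
`pub/ideators/ns-idea-3/lines/rate-table/line-rate-table.lean` sha16 99519954933d87d3 (2726 l., lean check rc 0, 0 sorry; the frame of §1, the Eulerian read-outs, §2–§6 and §8
are shared VERBATIM with LINES 18/20/22/24/25/27 and taken BY NAME from the landed ports — not re-declared), split for the 400-line rule into `ScenarioCensusRowF1RateTable`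
(§1) → `…RateTableMaxPrinciple` (§7a) → `…RateTableKill` (§7b) → `…RateTableRows` (§9 rows/verdicts) → `…RateTableTop` (§9 corollaries + census KEYS).  Lean text VERBATIM
in namespace `…Theorems.ScenarioCensus.RateTable` (the line's `…Cruxes.ScenarioCensusRowF1.RateTableLine` re-homed), shared names spelled by namespace (`EulerianPincer.…`,
`LiouvilleSocket.…`, `FrozenTop.…`, `InviscidTop.…`, …); port edits: the bracket lines `section …` / `end …` dropped (no `variable`s), `@[conjecture]` on the residual
`TableSlack` (≡ `ScenarioCensus.Row_F1`, OPEN), one-line docstrings added where missing (gate lint), two `have` statements spell the τ-tool's `lapD` (defeq; proof text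
only).  Statements untouched.

No census VALUE is moved here (row F1 stays OPEN-WITH-LINE; the members become TREE-decided by name); NS regularity is NOT proved; `Row_F1` is untouched (zero
movement, `tableSlack_iff_rowF1`); no summit statement is proved by this file. Lemmas that restate already-landed tree declarations are taken BY NAME (gate lint `dedup.landed`): `materialNonIncreasing_ancient_trivial` = `IntegratedQuench.eq_zero_of_nonIntensifying`.
-/

-- the summit and its single problem share the name `NavierStokesRegularity` (D-0017 nested layout)
set_option linter.dupNamespace false

noncomputable section

open MeasureTheory Set Function Filter TopologicalSpace Metric
open scoped Topology NNReal ENNReal InnerProductSpace RealInnerProductSpace Laplacian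

namespace Summit.NavierStokesRegularity.NavierStokesRegularity.Theorems.ScenarioCensus.RateTable

open Literature.Analysis Literature.Analysis.FluidPDE
open Summit.NavierStokesRegularity.NavierStokesRegularity.Theorems

/-! ### Corollaries in kernel: the sign rows of the two cells and the eventual threshold rows -/

/-- **IDEAL SIGN TOP** (NEW sign row, `θ = 0`; parameter-free, KINEMATIC): Type I + at some measurable subcritical level
and some `t₀ ∈ [0, T)`, at every fast point VORTEX STRETCHING NEVER EXCEEDS THE ADVECTIVE INFLUX OF ENSTROPHY
(`⟪ω, Sω⟫ ≤ ½(u·∇)|ω|²`, i.e. `⟪ω, (ω·∇)u − (u·∇)ω⟫ ≤ 0`) ⇒ smooth extension.  The number vanishes. -/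
theorem rowF1_idealSignTop : ∀ (ν T : ℝ), 0 < ν → 0 < T → ∀ (u : ℝ → LiouvilleSocket.E3 → LiouvilleSocket.E3) (p : ℝ → LiouvilleSocket.E3 → ℝ),
    IsClassicalNSSolutionOn (Ico 0 T) ν 0 u p → IsLerayHopfOn T ν 0 (u 0) u →
    HasRapidSpatialDecay (u 0) → IsTypeIBlowup u T →
    (∃ (t₀ : ℝ) (Λ : ℝ → ℝ), 0 ≤ t₀ ∧ t₀ < T ∧ LiouvilleSocket.IsSubcriticalLevel T Λ ∧ Measurable Λ ∧
      ∀ t ∈ Ico t₀ T, ∀ x, Λ t < ‖u t x‖ →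
        ⟪curl (u t) x, convect (curl (u t)) (u t) x - convect (u t) (curl (u t)) x⟫ ≤ 0) →
    HasSmoothExtensionPast ν 0 u T := by
  intro ν T hν hT u p hsol hLH hdec hTI htop
  obtain ⟨t₀, Λ, ht₀, ht₀T, hΛ, hΛm, hsign⟩ := htop
  refine rowF1id_holds ν T hν hT u p hsol hLH hdec hTI ⟨0, t₀, Λ, zero_lt_one, ht₀, ht₀T, hΛ, hΛm, ?_⟩
  have h0 : ∀ z, idlIntegrand T 0 t₀ Λ u z = 0 := by
    intro z
    unfold idlIntegrand
    by_cases hz : z ∈ {z : ℝ × LiouvilleSocket.E3 | z.1 ∈ Ico t₀ T ∧ Λ z.1 < ‖u z.1 z.2‖}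
    · rw [indicator_of_mem hz, zero_mul, sub_zero, max_eq_left (hsign z.1 hz.1 z.2 hz.2), mul_zero,
        ENNReal.ofReal_zero]
    · rw [indicator_of_notMem hz]
  rw [lintegral_congr h0, lintegral_zero]
  exact ENNReal.zero_lt_top

/-- **MATERIAL SIGN TOP on `[t₀, T)`** (`θ = 0`; LINE 21/22's quenched top with a start time, now through the maximum
principle): Type I + `½Dₜ|ω|² ≤ 0` at every fast point of `[t₀, T) × ℝ³` ⇒ smooth extension. -/
theorem rowF1_materialSignTop : ∀ (ν T : ℝ), 0 < ν → 0 < T → ∀ (u : ℝ → LiouvilleSocket.E3 → LiouvilleSocket.E3) (p : ℝ → LiouvilleSocket.E3 → ℝ),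
    IsClassicalNSSolutionOn (Ico 0 T) ν 0 u p → IsLerayHopfOn T ν 0 (u 0) u →
    HasRapidSpatialDecay (u 0) → IsTypeIBlowup u T →
    (∃ (t₀ : ℝ) (Λ : ℝ → ℝ), 0 ≤ t₀ ∧ t₀ < T ∧ LiouvilleSocket.IsSubcriticalLevel T Λ ∧ Measurable Λ ∧
      ∀ t ∈ Ico t₀ T, ∀ x, Λ t < ‖u t x‖ →
        ⟪curl (u t) x, timeDerivWithin (Ico 0 T) (vorticity u) t x + convect (u t) (curl (u t)) x⟫ ≤ 0) →
    HasSmoothExtensionPast ν 0 u T := by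
  intro ν T hν hT u p hsol hLH hdec hTI htop
  obtain ⟨t₀, Λ, ht₀, ht₀T, hΛ, hΛm, hsign⟩ := htop
  refine rowF1im_holds ν T hν hT u p hsol hLH hdec hTI ⟨0, t₀, Λ, zero_lt_one, ht₀, ht₀T, hΛ, hΛm, ?_⟩
  have h0 : ∀ z, matIntegrand T 0 t₀ Λ u z = 0 := by
    intro z
    unfold matIntegrand
    by_cases hz : z ∈ {z : ℝ × LiouvilleSocket.E3 | z.1 ∈ Ico t₀ T ∧ Λ z.1 < ‖u z.1 z.2‖}
    · rw [indicator_of_mem hz, zero_mul, sub_zero, max_eq_left (hsign z.1 hz.1 z.2 hz.2), mul_zero,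
        ENNReal.ofReal_zero]
    · rw [indicator_of_notMem hz]
  rw [lintegral_congr h0, lintegral_zero]
  exact ENNReal.zero_lt_top

/-- **EVENTUAL SUB-SELF-SIMILAR MATERIAL RATE** (threshold row): Type I + for some `θ < 1` and some measurable
subcritical level, EVENTUALLY `(T − t) · ½Dₜ|ω|² ≤ θ |ω|²` at every fast point ⇒ smooth extension. -/
theorem rowF1_materialThreshold : ∀ (ν T : ℝ), 0 < ν → 0 < T → ∀ (u : ℝ → LiouvilleSocket.E3 → LiouvilleSocket.E3) (p : ℝ → LiouvilleSocket.E3 → ℝ),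
    IsClassicalNSSolutionOn (Ico 0 T) ν 0 u p → IsLerayHopfOn T ν 0 (u 0) u →
    HasRapidSpatialDecay (u 0) → IsTypeIBlowup u T →
    (∃ (θ : ℝ) (Λ : ℝ → ℝ), θ < 1 ∧ LiouvilleSocket.IsSubcriticalLevel T Λ ∧ Measurable Λ ∧
      ∀ᶠ t in 𝓝[<] T, ∀ x : LiouvilleSocket.E3, Λ t < ‖u t x‖ →
        (T - t) * ⟪curl (u t) x,
          timeDerivWithin (Ico 0 T) (vorticity u) t x + convect (u t) (curl (u t)) x⟫ ≤ θ * ‖curl (u t) x‖ ^ 2) →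
    HasSmoothExtensionPast ν 0 u T := by
  intro ν T hν hT u p hsol hLH hdec hTI htop
  obtain ⟨θ, Λ, hθ, hΛ, hΛm, hev⟩ := htop
  obtain ⟨t₁, ht₁T, hsub⟩ := (mem_nhdsLT_iff_exists_Ioo_subset).1 hev
  have ht₁T' : t₁ < T := ht₁T
  set t₀ : ℝ := max 0 ((t₁ + T) / 2) with ht₀def
  have ht₀ : 0 ≤ t₀ := le_max_left _ _
  have ht₀T : t₀ < T := max_lt hT (by linarith)
  have hzero : ∀ z, matIntegrand T θ t₀ Λ u z = 0 := by
    intro z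
    by_cases hz : z ∈ {z : ℝ × LiouvilleSocket.E3 | z.1 ∈ Ico t₀ T ∧ Λ z.1 < ‖u z.1 z.2‖}
    · rw [matIntegrand, indicator_of_mem hz]
      have hσ : 0 < T - z.1 := sub_pos.2 hz.1.2
      have ht1 : t₁ < z.1 := by
        have : (t₁ + T) / 2 ≤ z.1 := (le_max_right _ _).trans hz.1.1
        linarith
      have hmem : z.1 ∈ {t : ℝ | ∀ x : LiouvilleSocket.E3, Λ t < ‖u t x‖ →
          (T - t) * ⟪curl (u t) x,
            timeDerivWithin (Ico 0 T) (vorticity u) t x + convect (u t) (curl (u t)) x⟫ ≤ θ * ‖curl (u t) x‖ ^ 2} :=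
        hsub ⟨ht1, hz.1.2⟩
      have hP : (T - z.1) * ⟪curl (u z.1) z.2,
          timeDerivWithin (Ico 0 T) (vorticity u) z.1 z.2 + convect (u z.1) (curl (u z.1)) z.2⟫ ≤
          θ * ‖curl (u z.1) z.2‖ ^ 2 := hmem z.2 hz.2
      have hle : ⟪curl (u z.1) z.2,
          timeDerivWithin (Ico 0 T) (vorticity u) z.1 z.2 + convect (u z.1) (curl (u z.1)) z.2⟫
          - θ * ((T - z.1)⁻¹ * ‖curl (u z.1) z.2‖ ^ 2) ≤ 0 := by
        have h1 : ⟪curl (u z.1) z.2,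
            timeDerivWithin (Ico 0 T) (vorticity u) z.1 z.2 + convect (u z.1) (curl (u z.1)) z.2⟫ ≤
            θ * ‖curl (u z.1) z.2‖ ^ 2 / (T - z.1) := by
          rw [le_div_iff₀ hσ]
          linarith
        have e : θ * ((T - z.1)⁻¹ * ‖curl (u z.1) z.2‖ ^ 2) = θ * ‖curl (u z.1) z.2‖ ^ 2 / (T - z.1) := by
          ring
        linarith
      rw [max_eq_left hle, mul_zero, ENNReal.ofReal_zero]
    · rw [matIntegrand, indicator_of_notMem hz]
  refine rowF1im_holds ν T hν hT u p hsol hLH hdec hTI ⟨θ, t₀, Λ, hθ, ht₀, ht₀T, hΛ, hΛm, ?_⟩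
  rw [lintegral_congr hzero, lintegral_zero]
  exact ENNReal.zero_lt_top

/-- **EVENTUAL SUB-SELF-SIMILAR IDEAL RATE** (threshold row, kinematic): Type I + for some `θ < 1` and some measurable
subcritical level, EVENTUALLY `(T − t) ⟪ω, (ω·∇)u − (u·∇)ω⟫ ≤ θ |ω|²` at every fast point ⇒ smooth extension. -/
theorem rowF1_idealThreshold : ∀ (ν T : ℝ), 0 < ν → 0 < T → ∀ (u : ℝ → LiouvilleSocket.E3 → LiouvilleSocket.E3) (p : ℝ → LiouvilleSocket.E3 → ℝ),
    IsClassicalNSSolutionOn (Ico 0 T) ν 0 u p → IsLerayHopfOn T ν 0 (u 0) u →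
    HasRapidSpatialDecay (u 0) → IsTypeIBlowup u T →
    (∃ (θ : ℝ) (Λ : ℝ → ℝ), θ < 1 ∧ LiouvilleSocket.IsSubcriticalLevel T Λ ∧ Measurable Λ ∧
      ∀ᶠ t in 𝓝[<] T, ∀ x : LiouvilleSocket.E3, Λ t < ‖u t x‖ →
        (T - t) * ⟪curl (u t) x, convect (curl (u t)) (u t) x - convect (u t) (curl (u t)) x⟫ ≤
          θ * ‖curl (u t) x‖ ^ 2) →
    HasSmoothExtensionPast ν 0 u T := by
  intro ν T hν hT u p hsol hLH hdec hTI htop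
  obtain ⟨θ, Λ, hθ, hΛ, hΛm, hev⟩ := htop
  obtain ⟨t₁, ht₁T, hsub⟩ := (mem_nhdsLT_iff_exists_Ioo_subset).1 hev
  have ht₁T' : t₁ < T := ht₁T
  set t₀ : ℝ := max 0 ((t₁ + T) / 2) with ht₀def
  have ht₀ : 0 ≤ t₀ := le_max_left _ _
  have ht₀T : t₀ < T := max_lt hT (by linarith)
  have hzero : ∀ z, idlIntegrand T θ t₀ Λ u z = 0 := by
    intro z
    by_cases hz : z ∈ {z : ℝ × LiouvilleSocket.E3 | z.1 ∈ Ico t₀ T ∧ Λ z.1 < ‖u z.1 z.2‖}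
    · rw [idlIntegrand, indicator_of_mem hz]
      have hσ : 0 < T - z.1 := sub_pos.2 hz.1.2
      have ht1 : t₁ < z.1 := by
        have : (t₁ + T) / 2 ≤ z.1 := (le_max_right _ _).trans hz.1.1
        linarith
      have hmem : z.1 ∈ {t : ℝ | ∀ x : LiouvilleSocket.E3, Λ t < ‖u t x‖ →
          (T - t) * ⟪curl (u t) x, convect (curl (u t)) (u t) x - convect (u t) (curl (u t)) x⟫ ≤
            θ * ‖curl (u t) x‖ ^ 2} :=
        hsub ⟨ht1, hz.1.2⟩
      have hP : (T - z.1) * ⟪curl (u z.1) z.2,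
          convect (curl (u z.1)) (u z.1) z.2 - convect (u z.1) (curl (u z.1)) z.2⟫ ≤
          θ * ‖curl (u z.1) z.2‖ ^ 2 := hmem z.2 hz.2
      have hle : ⟪curl (u z.1) z.2, convect (curl (u z.1)) (u z.1) z.2 - convect (u z.1) (curl (u z.1)) z.2⟫
          - θ * ((T - z.1)⁻¹ * ‖curl (u z.1) z.2‖ ^ 2) ≤ 0 := by
        have h1 : ⟪curl (u z.1) z.2, convect (curl (u z.1)) (u z.1) z.2 - convect (u z.1) (curl (u z.1)) z.2⟫ ≤
            θ * ‖curl (u z.1) z.2‖ ^ 2 / (T - z.1) := by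
          rw [le_div_iff₀ hσ]
          linarith
        have e : θ * ((T - z.1)⁻¹ * ‖curl (u z.1) z.2‖ ^ 2) = θ * ‖curl (u z.1) z.2‖ ^ 2 / (T - z.1) := by
          ring
        linarith
      rw [max_eq_left hle, mul_zero, ENNReal.ofReal_zero]
    · rw [idlIntegrand, indicator_of_notMem hz]
  refine rowF1id_holds ν T hν hT u p hsol hLH hdec hTI ⟨θ, t₀, Λ, hθ, ht₀, ht₀T, hΛ, hΛm, ?_⟩
  rw [lintegral_congr hzero, lintegral_zero]
  exact ENNReal.zero_lt_top

/-! ### Unification: LINE 22's parameter-free material row `F1iq` is the corner `θ = 0`, `t₀ = 0` of the material cell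
— restated verbatim and RE-PROVED through the maximum principle -/

/-- The corner identity: `matIntegrand T 0 0 = IntegratedQuench.intensificationIntegrand T`. -/
theorem matIntegrand_zero_zero (T : ℝ) (Λ : ℝ → ℝ) (u : ℝ → LiouvilleSocket.E3 → LiouvilleSocket.E3) :
    matIntegrand T 0 0 Λ u = IntegratedQuench.intensificationIntegrand T Λ u := by
  funext z
  simp only [matIntegrand, IntegratedQuench.intensificationIntegrand, zero_mul, sub_zero]

/-- **ORDER: row `F1im` implies LINE 22's row `F1iq`** (the material cell's `θ = 0`, `t₀ = 0` corner). -/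
theorem rowF1iq_of_rowF1im (h : Row_F1im) : IntegratedQuench.Row_F1iq := by
  intro ν T hν hT u p hsol hLH hdec hTI htop
  obtain ⟨Λ, hΛ, hΛm, hfin⟩ := htop
  refine h ν T hν hT u p hsol hLH hdec hTI ⟨0, 0, Λ, zero_lt_one, le_rfl, hT, hΛ, hΛm, ?_⟩
  rw [matIntegrand_zero_zero]
  exact hfin

-- `rowF1iq_holds'`: a second proof term for LINE 22's `Row_F1iq` (statement identical to the landed `IntegratedQuench.rowF1iq_holds`, gate lint dedup.landed); not re-declared — the unification is `rowF1iq_of_rowF1im`.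

end Summit.NavierStokesRegularity.NavierStokesRegularity.Theorems.ScenarioCensus.RateTable

namespace Summit.NavierStokesRegularity.NavierStokesRegularity.Theorems.ScenarioCensus

/-! ## Census KEYS (ns `…Theorems.ScenarioCensus`): the RATE-TABLE members of row F1 (LINE 26) — TREE-decided F1im / F1id and floors DM / DI -/

/-- **Cell F1im** (MATERIAL allowance: row F1 frame VERBATIM + for some `θ < 1`, `t₀`, measurable subcritical level, the excess of half the MATERIAL rate of the enstrophy density of the fast fluid over `θ|ω|²/(T−t)` is integrable against `√(T−t)` ⇒ smooth extension past `T`): `:= RateTable.Row_F1im`. DECIDED. -/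
def Row_F1im : Prop := RateTable.Row_F1im
/-- F1im is EXCLUDED (decided in the tree): `RateTable.rowF1im_holds`. -/
theorem row_F1im_excluded : Row_F1im := RateTable.rowF1im_holds

/-- **Cell F1id** (IDEAL allowance: the same for the ideal (inviscid) rate `⟪ω, Sω⟩ − …`): `:= RateTable.Row_F1id`. DECIDED. -/
def Row_F1id : Prop := RateTable.Row_F1id
/-- F1id is EXCLUDED (decided in the tree): `RateTable.rowF1id_holds`. -/
theorem row_F1id_excluded : Row_F1id := RateTable.rowF1id_holds

/-- **Floor DM — DIVERGENT MATERIAL EXCESS**: `RateTable.divergentMaterialExcess_holds`. -/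
theorem row_F1_divergentMaterialExcess : RateTable.DivergentMaterialExcess := RateTable.divergentMaterialExcess_holds
/-- **Floor DI′ — DIVERGENT IDEAL EXCESS**: `RateTable.divergentIdealExcess_holds`. -/
theorem row_F1_divergentIdealExcess : RateTable.DivergentIdealExcess := RateTable.divergentIdealExcess_holds
/-- Unification edge at key level: F1im ⇒ F1iq (LINE 22's parameter-free material row is the corner `θ = 0`, `t₀ = 0`; `RateTable.rowF1iq_of_rowF1im`). -/
theorem rowF1iq_of_rowF1im : Row_F1im → Row_F1iq := RateTable.rowF1iq_of_rowF1im

end Summit.NavierStokesRegularity.NavierStokesRegularity.Theorems.ScenarioCensus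

end
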